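import Mathlib
import Literature.NumberTheory.LFunctions.Zhang2022.SkeletonPartTwo
import Literature.NumberTheory.LFunctions.Zhang2022.SkeletonReductions
import Literature.NumberTheory.LFunctions.Zhang2022.SkeletonPartOneC
import HarnessLib

/-!
# Zhang (2022) §18, proof of (2.33): the leaf `Ded183` from the crude bound, kernel-checked

Topic `Literature/NumberTheory/LFunctions/Zhang2022` (Landau–Siegel audit tree; verdict-neutral).
Y. Zhang, *Discrete mean estimates and the Landau–Siegel zero*, arXiv:2211.02515v1 (2022)
[Zhang2022LandauSiegel], §18 pp. 99–100 (tex L4914–L4955), "Proof of (2.33)" — an unrefereed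
manuscript under adjudication (campaign D-0069, discharge layer L4; DAG nodes `Z22:(2.33).pf`,
`Z22:§18.u013`, `Z22:§18.u014`; cone leaf C27 = the skeleton's proof node `Skeleton.Ded183 c′ :=
Eq183 → Prop71 → Lemma101 → Lemma102 → Bound183`, `SkeletonPartTwo`).

The printed block ends: "Thus we have the crude bound `Re{S_j(𝐚₂₃,𝐚₂₃)} < 1100𝔞/log P`, so that
`Re{(1/2α)S₁ + (2/α)S₂ + (3/2α)S₃} < 4400𝔞/π`. This yields (2.33) by Lemma 8.1 and Proposition 7.1."
This file kernel-checks exactly that ending, with every hypothesis a typed claim of the manuscript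
(stated in the skeleton's shapes; the bodies are verbatim those of the §18 typed file
`TypedSection18` — `Step18_u013`, `Step18_u014` — so the bridge is definitional once it lands):

* `step18_u014_of_u013` — the "so that": `u013 ⇒ u014` (`α log P = π`, (2.6)/(2.10));
* `bound183_of_steps` — "(18.3) + Proposition 7.1 + u014 ⇒ `Ξ_J ≤ (8800/π)𝔞𝔓 + o(𝔓)`"
  (`Skeleton.Bound183`), GIVEN the negligibility of Prop. 7.1's error term `O(E(𝐚₂₃,𝐚₂₃))`
  (an IMPLICIT input, stated inline: `E = 𝔓𝓛²Σ_j|S_j| = o(𝔓)` needs the two-sided size of `S_j`,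
  which the one-sided printed u013/u014 do not give; cf. `TypedSection08C.EcalNegligible` at (8.23));
* `ecal23Negligible_of_sjNorm` — the implicit input from any two-sided bound
  `|S_j(𝐚₂₃,𝐚₂₃)| ≪ (𝔞+1)/log P` (the size the §18 range evaluations u010–u012 display), via
  `𝔞 ≪ 𝓛⁴` (from the tree's Cauchy bound `L′(1,χ) ≪ 𝓛²`, `Lemma31.norm_deriv_LFunction_le_near_one`);
* `ded183_of_steps` — **the leaf**: `u013 ⇒ (E(𝐚₂₃,𝐚₂₃) = o(𝔓)) ⇒ Skeleton.Ded183 c′`;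
* `ineq233_of_steps` — and (2.33) itself (`Skeleton.Ineq233`) through the banked `ineq233_of_bound`.

So the cone leaf C27 reduces EXACTLY to the printed crude bound `Z22:§18.u013` plus the implicit
two-sided size of `S_j(𝐚₂₃,𝐚₂₃)`; Lemmas 10.1–10.2 (the other antecedents of `Ded183`) are the
manuscript's inputs FOR u013 and are not used again here. No new external fact; nothing here
asserts u013, Prop. 7.1, (18.3), or says anything about Theorems 1–2 / Landau–Siegel zeros.

## References

* Y. Zhang, arXiv:2211.02515v1 (2022), §18 pp. 99–100; §7 Prop. 7.1; §2 (2.6), (2.9), (2.10),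
  (2.31), (2.33). [cite: Zhang2022LandauSiegel, §18 pp. 99–100]
-/

noncomputable section

open Complex Real ComplexConjugate

namespace Literature.NumberTheory.LFunctions.Zhang2022.Sec18Ded183

open Skeleton

/-! ## Sizes: `α log P = π`, `𝔞 ≪ 𝓛⁴` -/

section Sizes

variable {D : ℕ}

/-- `log P = 𝓛⁹ > 0` for `D ≥ 3` ((2.6)). [cite: Zhang2022LandauSiegel, §2 (2.6)] -/
theorem log_bigP_pos (hD : 3 ≤ D) : 0 < Real.log (bigP D) := by
  rw [log_bigP]
  exact pow_pos (lt_trans one_pos (one_lt_ell hD)) 9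

/-- **`α log P = π`** ((2.10): `α = π/log P`). [cite: Zhang2022LandauSiegel, §2 (2.10)] -/
theorem alpha_mul_log_bigP (hD : 3 ≤ D) : alpha D * Real.log (bigP D) = π := by
  rw [alpha]
  exact div_mul_cancel₀ _ (log_bigP_pos hD).ne'

variable [NeZero D] (χ : DirichletCharacter ℂ D)

/-- `𝔞 ≤ (24e⁹/π²)((1+𝓛)𝓛)²` for `χ` primitive, `𝓛 = log D ≥ 3` ((2.31):
`𝔞 = (6/π²)L′(1,χ)²∏_{q∣D} q/(q+1)`, the product is `≤ 1`, and `|L′(1,χ)| ≤ 2e^{9/2}(1+𝓛)𝓛` by the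
tree's Cauchy estimate `Lemma31.norm_deriv_LFunction_le_near_one`; cf. the tree's
`Skeleton.frakA_le_ell_pow_four`). [cite: Zhang2022LandauSiegel, §2 (2.31)] -/
private theorem frakA_le_of_three_le_ell (hL : 3 ≤ ell D) (hprim : χ.IsPrimitive) :
    frakA χ ≤ 24 * Real.exp 9 / π ^ 2 * ((1 + ell D) * ell D) ^ 2 := by
  have hL' : 3 ≤ Real.log D := hL
  have hd : ‖deriv χ.LFunction 1‖ ≤ 2 * Real.exp (9 / 2) * (1 + Real.log D) * Real.log D :=
    Lemma31.norm_deriv_LFunction_le_near_one χ hL' hprim (w := 1) (by simp; positivity)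
  have hre : (deriv χ.LFunction 1).re ^ 2 ≤ (2 * Real.exp (9 / 2) * (1 + ell D) * ell D) ^ 2 := by
    have h1 : |(deriv χ.LFunction 1).re| ≤ ‖deriv χ.LFunction 1‖ := Complex.abs_re_le_norm _
    have h2 : |(deriv χ.LFunction 1).re| ≤ 2 * Real.exp (9 / 2) * (1 + ell D) * ell D :=
      h1.trans hd
    calc (deriv χ.LFunction 1).re ^ 2 = |(deriv χ.LFunction 1).re| ^ 2 := (sq_abs _).symm
      _ ≤ (2 * Real.exp (9 / 2) * (1 + ell D) * ell D) ^ 2 :=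
          pow_le_pow_left₀ (abs_nonneg _) h2 2
  have hprod : ∏ p ∈ D.primeFactors, ((p : ℝ) / (p + 1)) ≤ 1 :=
    Finset.prod_le_one (fun p _ => by positivity) fun p _ => by
      rw [div_le_one (by positivity)]; linarith
  have hexp : Real.exp (9 / 2) ^ 2 = Real.exp 9 := by
    rw [← Real.exp_nat_mul]; norm_num
  rw [frakA, Lemma171.frakA]
  calc 6 / π ^ 2 * (deriv χ.LFunction 1).re ^ 2 * ∏ p ∈ D.primeFactors, ((p : ℝ) / (p + 1))
      ≤ 6 / π ^ 2 * (2 * Real.exp (9 / 2) * (1 + ell D) * ell D) ^ 2 * 1 := by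
        gcongr
    _ = 24 * Real.exp 9 / π ^ 2 * ((1 + ell D) * ell D) ^ 2 := by
        rw [← hexp]; ring

end Sizes

/-! ## The implicit input: Proposition 7.1's error term at `𝐚₂₃` -/

section Implicit

variable (c' : ℝ)

/-! IMPLICIT INPUT of "This yields (2.33) by Lemma 8.1 and Proposition 7.1" (Z22 p.100,
tex L4955): the error term `O(E(𝐚₂₃,𝐚₂₃))` of Prop. 7.1, `E = 𝔓𝓛²Σ_{1≤j≤3}|S_j(𝐚₂₃,𝐚₂₃)|`, must be
`o(𝔓)` — stated below always INLINE as the hypothesis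
`∀ ε > 0, ForAllLarge (… (A) → Ecal c′ D 𝐚₂₃ 𝐚₂₃ ≤ ε𝔓)` (no new claim node is declared here). It is
not displayed in print: it needs the two-sided size of `S_j(𝐚₂₃,𝐚₂₃)`, of which the printed crude
bound u013 is only the upper real side; `ecal23Negligible_of_sjNorm` derives it from any bound
`|S_j| ≪ (𝔞+1)/log P`, the size the §18 range evaluations display. (The §8 analogue at (8.23) is
`TypedSection08C.EcalNegligible`.) -/

/-- For every real `M` there is `D₀` with `M ≤ log D` for all `D ≥ D₀`. [folklore] -/
private theorem exists_nat_le_log (M : ℝ) : ∃ D₀ : ℕ, ∀ D : ℕ, D₀ ≤ D → M ≤ Real.log D := by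
  refine ⟨⌈Real.exp M⌉₊ + 1, fun D hD => ?_⟩
  have h1 : Real.exp M ≤ D := by
    have : (⌈Real.exp M⌉₊ : ℝ) + 1 ≤ D := by exact_mod_cast hD
    linarith [Nat.le_ceil (Real.exp M)]
  have hD0 : (0 : ℝ) < D := lt_of_lt_of_le (Real.exp_pos M) h1
  rw [Real.le_log_iff_exp_le hD0]
  exact h1

/-- **The implicit input from a two-sided size bound**: if `|S_j(𝐚₂₃,𝐚₂₃)| ≤ C(𝔞+1)/log P`
(`1 ≤ j ≤ 3`, all large `D`, under (A)) — the size displayed by the §18 range evaluations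
(`(500L′/log P)²Σ… = 1000𝔞/log P + o(α)`) — then `E(𝐚₂₃,𝐚₂₃) = 𝔓𝓛²Σ|S_j| ≤ 3|C|(𝔞+1)𝓛²⁻⁹𝔓 = o(𝔓)`,
by `log P = 𝓛⁹` and `𝔞 ≪ 𝓛⁴`. [cite: Zhang2022LandauSiegel, §18 p.100; §7 Prop. 7.1] -/
theorem ecal23Negligible_of_sjNorm
    (h : ∃ C : ℝ, ForAllLarge fun D _ χ => AssumptionA D χ → ∀ j ∈ ({1, 2, 3} : Finset ℕ),
      ‖Sj c' D j (a23 χ) (a23 χ)‖ ≤ C * (frakA χ + 1) / Real.log (bigP D)) :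
    ∀ ε : ℝ, 0 < ε → ForAllLarge fun D _ χ => AssumptionA D χ →
      Ecal c' D (a23 χ) (a23 χ) ≤ ε * frakP D := by
  intro ε hε
  obtain ⟨C, D₁, hC⟩ := h
  -- the constant of `𝔞 ≪ 𝓛⁴`
  set K : ℝ := 96 * Real.exp 9 / π ^ 2 with hK
  have hK0 : 0 ≤ K := by positivity
  -- choose `𝓛 ≥ max 3 (3|C|(K+1)/ε + 1)`
  obtain ⟨D₂, hD₂⟩ := exists_nat_le_log (max 3 (3 * |C| * (K + 1) / ε + 1))
  refine ⟨max D₁ D₂, fun D _ χ hD hq hp hA => ?_⟩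
  have hD1 : D₁ ≤ D := le_trans (le_max_left _ _) hD
  have hlog : max 3 (3 * |C| * (K + 1) / ε + 1) ≤ ell D := hD₂ D (le_trans (le_max_right _ _) hD)
  have hL3 : 3 ≤ ell D := le_trans (le_max_left _ _) hlog
  have hLbig : 3 * |C| * (K + 1) / ε + 1 ≤ ell D := le_trans (le_max_right _ _) hlog
  have hL1 : 1 ≤ ell D := by linarith
  have hL0 : 0 < ell D := by linarith
  have hP : 0 ≤ frakP D := frakP_nonneg D
  have hA0 : 0 ≤ frakA χ := frakA_nonneg χ
  have hAK : frakA χ ≤ K * ell D ^ 4 := by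
    have h := frakA_le_of_three_le_ell χ hL3 hp
    have h1 : ((1 + ell D) * ell D) ^ 2 ≤ (2 * ell D * ell D) ^ 2 := by
      apply pow_le_pow_left₀ (by positivity)
      nlinarith
    calc frakA χ ≤ 24 * Real.exp 9 / π ^ 2 * ((1 + ell D) * ell D) ^ 2 := h
      _ ≤ 24 * Real.exp 9 / π ^ 2 * (2 * ell D * ell D) ^ 2 := by gcongr
      _ = K * ell D ^ 4 := by rw [hK]; ring
  have hlogP : Real.log (bigP D) = ell D ^ 9 := log_bigP D
  -- each `‖S_j‖ ≤ |C|(𝔞+1)/𝓛⁹`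
  have hS : ∀ j ∈ ({1, 2, 3} : Finset ℕ),
      ‖Sj c' D j (a23 χ) (a23 χ)‖ ≤ |C| * (frakA χ + 1) / ell D ^ 9 := by
    intro j hj
    have h1 := hC D χ hD1 hq hp hA j hj
    rw [hlogP] at h1
    refine h1.trans ?_
    gcongr
    exact le_abs_self C
  have h1 := hS 1 (by simp)
  have h2 := hS 2 (by simp)
  have h3 := hS 3 (by simp)
  -- `(𝔞+1) ≤ (K+1)𝓛⁴`
  have hA1 : frakA χ + 1 ≤ (K + 1) * ell D ^ 4 := by
    have : (1 : ℝ) ≤ ell D ^ 4 := one_le_pow₀ hL1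
    nlinarith
  -- the sum of the three norms
  have hsum : ‖Sj c' D 1 (a23 χ) (a23 χ)‖ + ‖Sj c' D 2 (a23 χ) (a23 χ)‖ +
      ‖Sj c' D 3 (a23 χ) (a23 χ)‖ ≤ 3 * |C| * (K + 1) * ell D ^ 4 / ell D ^ 9 := by
    have hb : |C| * (frakA χ + 1) / ell D ^ 9 ≤ |C| * ((K + 1) * ell D ^ 4) / ell D ^ 9 := by
      gcongr
    have e : 3 * |C| * (K + 1) * ell D ^ 4 / ell D ^ 9 =
        3 * (|C| * ((K + 1) * ell D ^ 4) / ell D ^ 9) := by ring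
    rw [e]
    linarith
  -- `𝓛² · 3|C|(K+1)𝓛⁴/𝓛⁹ = 3|C|(K+1)/𝓛³ ≤ 3|C|(K+1)/𝓛 ≤ ε`
  have hkey : ell D ^ 2 * (3 * |C| * (K + 1) * ell D ^ 4 / ell D ^ 9) ≤ ε := by
    have e : ell D ^ 2 * (3 * |C| * (K + 1) * ell D ^ 4 / ell D ^ 9) =
        3 * |C| * (K + 1) / ell D ^ 3 := by
      field_simp
    rw [e]
    have hL3' : ell D ≤ ell D ^ 3 := by
      calc ell D = ell D ^ 1 := (pow_one _).symm
        _ ≤ ell D ^ 3 := pow_le_pow_right₀ hL1 (by norm_num)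
    have hnum : 0 ≤ 3 * |C| * (K + 1) := by positivity
    calc 3 * |C| * (K + 1) / ell D ^ 3 ≤ 3 * |C| * (K + 1) / ell D :=
          div_le_div_of_nonneg_left hnum hL0 hL3'
      _ ≤ ε := by
          rw [div_le_iff₀ hL0]
          have : 3 * |C| * (K + 1) / ε ≤ ell D - 1 := by linarith
          have h' := (div_le_iff₀ hε).mp this
          nlinarith
  unfold Ecal
  calc frakP D * ell D ^ 2 *
        (‖Sj c' D 1 (a23 χ) (a23 χ)‖ + ‖Sj c' D 2 (a23 χ) (a23 χ)‖ + ‖Sj c' D 3 (a23 χ) (a23 χ)‖)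
      ≤ frakP D * ell D ^ 2 * (3 * |C| * (K + 1) * ell D ^ 4 / ell D ^ 9) := by gcongr
    _ = frakP D * (ell D ^ 2 * (3 * |C| * (K + 1) * ell D ^ 4 / ell D ^ 9)) := by ring
    _ ≤ frakP D * ε := by gcongr
    _ = ε * frakP D := mul_comm _ _

end Implicit

/-! ## The printed ending of the proof of (2.33) -/

section Ending

variable (c' : ℝ)

/-- The real part of the main term of Proposition 7.1: for real `α`, `𝔓`,
`Re{α⁻¹(½S₁ + 2S₂ + 3/2·S₃)𝔓} = α⁻¹(½Re S₁ + 2Re S₂ + 3/2·Re S₃)𝔓`.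
[cite: Zhang2022LandauSiegel, §7 Prop. 7.1] -/
theorem mainMV_re (D : ℕ) (a₁ a₂ : ℕ → ℂ) :
    (mainMV c' D a₁ a₂).re = (alpha D)⁻¹ *
      (1 / 2 * (Sj c' D 1 a₁ a₂).re + 2 * (Sj c' D 2 a₁ a₂).re + 3 / 2 * (Sj c' D 3 a₁ a₂).re) *
      frakP D := by
  rw [mainMV, ← Complex.ofReal_inv, Complex.re_mul_ofReal, Complex.re_ofReal_mul]
  congr 2
  simp only [Complex.add_re, Complex.mul_re, Complex.div_ofNat_re, Complex.one_re,
    Complex.div_ofNat_im, Complex.one_im, zero_div, zero_mul, sub_zero, Complex.re_ofNat,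
    Complex.im_ofNat]

/-- The printed combination of u014 equals `Re` of Prop. 7.1's bracket: for real `α ≠ 0`,
`Re{(1/2α)S₁ + (2/α)S₂ + (3/2α)S₃} = α⁻¹(½Re S₁ + 2Re S₂ + 3/2·Re S₃)`.
[cite: Zhang2022LandauSiegel, §18 p.100] -/
theorem combination_re {D : ℕ} (hα : alpha D ≠ 0) (S₁ S₂ S₃ : ℂ) :
    (1 / (2 * (alpha D : ℂ)) * S₁ + 2 / (alpha D : ℂ) * S₂ + 3 / (2 * (alpha D : ℂ)) * S₃).re =
      (alpha D)⁻¹ * (1 / 2 * S₁.re + 2 * S₂.re + 3 / 2 * S₃.re) := by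
  have e : (1 / (2 * (alpha D : ℂ)) * S₁ + 2 / (alpha D : ℂ) * S₂ + 3 / (2 * (alpha D : ℂ)) * S₃) =
      ((alpha D)⁻¹ : ℝ) * (1 / 2 * S₁ + 2 * S₂ + 3 / 2 * S₃) := by
    have hα' : (alpha D : ℂ) ≠ 0 := Complex.ofReal_ne_zero.mpr hα
    push_cast
    field_simp
  rw [e, Complex.re_ofReal_mul]
  congr 1
  simp only [Complex.add_re, Complex.mul_re, Complex.div_ofNat_re, Complex.one_re,
    Complex.div_ofNat_im, Complex.one_im, zero_div, zero_mul, sub_zero, Complex.re_ofNat,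
    Complex.im_ofNat]

/-- **`Z22:§18.u014` from `Z22:§18.u013`** (Z22 p.100, tex L4947–L4953: "Thus we have the crude bound
`Re{S_j(𝐚₂₃,𝐚₂₃)} < 1100𝔞/log P`, so that `Re{(1/2α)S₁ + (2/α)S₂ + (3/2α)S₃} < 4400𝔞/π`"):
`(1/2 + 2 + 3/2)·1100𝔞/(α log P) = 4400𝔞/π` since `α log P = π` ((2.10)). The hypothesis and the
conclusion are verbatim the bodies of `TypedSection18.Step18_u013 c′` / `Step18_u014 c′`.
Kernel-checked. [cite: Zhang2022LandauSiegel, §18 p.100] -/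
theorem step18_u014_of_u013
    (h13 : ForAllLarge fun D _ χ => AssumptionA D χ → ∀ j ∈ ({1, 2, 3} : Finset ℕ),
      (Sj c' D j (a23 χ) (a23 χ)).re < 1100 * frakA χ / Real.log (bigP D)) :
    ForAllLarge fun D _ χ => AssumptionA D χ →
      (1 / (2 * (alpha D : ℂ)) * Sj c' D 1 (a23 χ) (a23 χ) +
            2 / (alpha D : ℂ) * Sj c' D 2 (a23 χ) (a23 χ) +
            3 / (2 * (alpha D : ℂ)) * Sj c' D 3 (a23 χ) (a23 χ)).re <
        4400 * frakA χ / π := by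
  obtain ⟨D₁, h⟩ := h13
  refine ⟨max D₁ 3, fun D _ χ hD hq hp hA => ?_⟩
  have hD3 : 3 ≤ D := le_trans (le_max_right _ _) hD
  have h' := h D χ (le_trans (le_max_left _ _) hD) hq hp hA
  have h1 := h' 1 (by simp)
  have h2 := h' 2 (by simp)
  have h3 := h' 3 (by simp)
  have hα : 0 < alpha D := alpha_pos hD3
  have hlogP : 0 < Real.log (bigP D) := log_bigP_pos hD3
  rw [combination_re hα.ne']
  set X : ℝ := 1100 * frakA χ / Real.log (bigP D) with hX
  have hlt : 1 / 2 * (Sj c' D 1 (a23 χ) (a23 χ)).re + 2 * (Sj c' D 2 (a23 χ) (a23 χ)).re +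
      3 / 2 * (Sj c' D 3 (a23 χ) (a23 χ)).re < 4 * X := by linarith
  have e : (alpha D)⁻¹ * (4 * X) = 4400 * frakA χ / π := by
    rw [hX, ← alpha_mul_log_bigP hD3]
    field_simp
    ring
  calc (alpha D)⁻¹ * (1 / 2 * (Sj c' D 1 (a23 χ) (a23 χ)).re + 2 * (Sj c' D 2 (a23 χ) (a23 χ)).re +
        3 / 2 * (Sj c' D 3 (a23 χ) (a23 χ)).re) < (alpha D)⁻¹ * (4 * X) :=
        mul_lt_mul_of_pos_left hlt (inv_pos.mpr hα)
    _ = 4400 * frakA χ / π := e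

/-- **`Skeleton.Bound183` from (18.3), Proposition 7.1, u014 and the implicit error-term control**
(Z22 p.100, tex L4950–L4955: "… `< 4400𝔞/π`. This yields (2.33) by Lemma 8.1 and Proposition 7.1"):
`Ξ_J = 2Re Θ₁(𝐚₂₃,𝐚₂₃) + o(𝔓)` ((18.3), `Skeleton.Eq183`), `Θ₁ = α⁻¹(½S₁+2S₂+3/2S₃)𝔓 + O(E) + o(𝔓)`
(Prop. 7.1 at `𝐚₁ = 𝐚₂ = 𝐚₂₃`, admissible by `Skeleton.adm72_a23`), `E = o(𝔓)` (the implicit input `hE`),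
and `Re{…} < 4400𝔞/π` (u014, verbatim the body of `TypedSection18.Step18_u014 c′`) give
`Ξ_J ≤ (8800/π)𝔞𝔓 + ε𝔓`. Pure `ε/3`-bookkeeping; kernel-checked.
[cite: Zhang2022LandauSiegel, §18 p.100] -/
theorem bound183_of_steps (h183 : Eq183 c') (h71 : Prop71 c')
    (h14 : ForAllLarge fun D _ χ => AssumptionA D χ →
      (1 / (2 * (alpha D : ℂ)) * Sj c' D 1 (a23 χ) (a23 χ) +
            2 / (alpha D : ℂ) * Sj c' D 2 (a23 χ) (a23 χ) +
            3 / (2 * (alpha D : ℂ)) * Sj c' D 3 (a23 χ) (a23 χ)).re <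
        4400 * frakA χ / π)
    (hE : ∀ ε : ℝ, 0 < ε → ForAllLarge fun D _ χ => AssumptionA D χ →
      Ecal c' D (a23 χ) (a23 χ) ≤ ε * frakP D) :
    Bound183 c' := by
  intro ε hε
  obtain ⟨C, h71'⟩ := h71 1 (ε / 6) (by positivity)
  have hC1 : 0 < |C| + 1 := by positivity
  obtain ⟨D₀, h⟩ := (((h183 (ε / 3) (by positivity)).and h71').and h14).and
    (hE (ε / (6 * (|C| + 1))) (by positivity))
  obtain ⟨D₂, hD₂⟩ := exists_nat_le_log 3
  refine ⟨max D₀ D₂, fun D _ χ hD hq hp hA => ?_⟩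
  obtain ⟨⟨⟨h183D, h71D⟩, h14D⟩, hED⟩ := h D χ (le_trans (le_max_left _ _) hD) hq hp
  have hlog3 : 3 ≤ Real.log D := hD₂ D (le_trans (le_max_right _ _) hD)
  have hlog2 : 2 ≤ Real.log D := by linarith
  have hD3 : 3 ≤ D := by
    by_contra hlt
    push Not at hlt
    have : Real.log D < 3 := by
      have hD' : (D : ℝ) < 3 := by exact_mod_cast hlt
      rcases Nat.eq_zero_or_pos D with h0 | hpos
      · simp [h0]
      · have hD0 : (0 : ℝ) < D := by exact_mod_cast hpos
        calc Real.log D < Real.log 3 := Real.log_lt_log hD0 hD'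
          _ ≤ 3 := by
            have : Real.log 3 < 3 := by
              have h := Real.log_lt_sub_one_of_pos (by norm_num : (0:ℝ) < 3) (by norm_num)
              linarith
            exact this.le
    linarith
  have hP : 0 ≤ frakP D := frakP_nonneg D
  have hα : 0 < alpha D := alpha_pos hD3
  -- Prop. 7.1 at `𝐚₂₃, 𝐚₂₃`
  have hadm : Adm72 D 1 (a23 χ) := adm72_a23 χ hlog2
  have e1 : ‖Theta1 c' χ (a23 χ) (a23 χ) - mainMV c' D (a23 χ) (a23 χ)‖ ≤
      C * Ecal c' D (a23 χ) (a23 χ) + ε / 6 * frakP D := h71D hA (a23 χ) (a23 χ) hadm hadm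
  have e3 : Ecal c' D (a23 χ) (a23 χ) ≤ ε / (6 * (|C| + 1)) * frakP D := hED hA
  have hEnn : 0 ≤ Ecal c' D (a23 χ) (a23 χ) := by
    unfold Ecal
    exact mul_nonneg (mul_nonneg hP (sq_nonneg _)) (by positivity)
  have e4 : C * Ecal c' D (a23 χ) (a23 χ) ≤ ε / 6 * frakP D := by
    have k1 : C * Ecal c' D (a23 χ) (a23 χ) ≤ |C| * Ecal c' D (a23 χ) (a23 χ) :=
      mul_le_mul_of_nonneg_right (le_abs_self C) hEnn
    have k2 : |C| * Ecal c' D (a23 χ) (a23 χ) ≤ |C| * (ε / (6 * (|C| + 1)) * frakP D) :=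
      mul_le_mul_of_nonneg_left e3 (abs_nonneg C)
    have key : |C| * (ε / (6 * (|C| + 1))) ≤ ε / 6 := by
      have e : |C| * (ε / (6 * (|C| + 1))) = ε / 6 * (|C| / (|C| + 1)) := by
        field_simp
      rw [e]
      exact mul_le_of_le_one_right (by positivity) ((div_le_one hC1).mpr (by linarith))
    have k3 : |C| * (ε / (6 * (|C| + 1)) * frakP D) ≤ ε / 6 * frakP D := by
      rw [← mul_assoc]
      exact mul_le_mul_of_nonneg_right key hP
    linarith
  -- hence `Re Θ₁ ≤ Re mainMV + (ε/3)𝔓`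
  have e5 : (Theta1 c' χ (a23 χ) (a23 χ)).re ≤ (mainMV c' D (a23 χ) (a23 χ)).re + ε / 3 * frakP D := by
    have k := Complex.abs_re_le_norm (Theta1 c' χ (a23 χ) (a23 χ) - mainMV c' D (a23 χ) (a23 χ))
    rw [Complex.sub_re] at k
    have k' := (abs_le.mp (k.trans e1)).2
    linarith
  -- `Re mainMV ≤ (4400/π)𝔞𝔓` by u014
  have e6 : (mainMV c' D (a23 χ) (a23 χ)).re ≤ 4400 * frakA χ / π * frakP D := by
    rw [mainMV_re, ← combination_re hα.ne']
    exact mul_le_mul_of_nonneg_right (h14D hA).le hP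
  -- (18.3): `Ξ_J ≤ 2Re Θ₁ + (ε/3)𝔓`
  have e7 := (abs_le.mp (h183D hA)).2
  have e8 : 8800 / π * frakA χ * frakP D = 2 * (4400 * frakA χ / π * frakP D) := by ring
  rw [e8]
  linarith

/-- **The cone leaf C27, `Skeleton.Ded183 c′`, from the printed crude bound** (Z22 p.100,
tex L4947–L4955): given `Z22:§18.u013` (verbatim the body of `TypedSection18.Step18_u013 c′`:
"`Re{S_j(𝐚₂₃,𝐚₂₃)} < 1100𝔞/log P`", `1 ≤ j ≤ 3`, under (A)) and the implicit error-term control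
`hE : E(𝐚₂₃,𝐚₂₃) = o(𝔓)`, the skeleton's proof node `Ded183 c′ := Eq183 → Prop71 → Lemma101 → Lemma102
→ Bound183` HOLDS (Lemmas 10.1–10.2 are the manuscript's inputs for u013 itself — "By the discussion
in Section 8 and 10" — and are not used again). So the leaf reduces exactly to u013 + the implicit
two-sided size of `S_j(𝐚₂₃,𝐚₂₃)`. Kernel-checked. [cite: Zhang2022LandauSiegel, §18 pp.99–100] -/
theorem ded183_of_steps
    (h13 : ForAllLarge fun D _ χ => AssumptionA D χ → ∀ j ∈ ({1, 2, 3} : Finset ℕ),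
      (Sj c' D j (a23 χ) (a23 χ)).re < 1100 * frakA χ / Real.log (bigP D))
    (hE : ∀ ε : ℝ, 0 < ε → ForAllLarge fun D _ χ => AssumptionA D χ →
      Ecal c' D (a23 χ) (a23 χ) ≤ ε * frakP D) :
    Ded183 c' :=
  fun h183 h71 _ _ => bound183_of_steps c' h183 h71 (step18_u014_of_u013 c' h13) hE

/-- The same leaf from u013 and any two-sided bound `|S_j(𝐚₂₃,𝐚₂₃)| ≤ C(𝔞+1)/log P` (the size the
§18 range evaluations u010–u012 display), via `ecal23Negligible_of_sjNorm`.
[cite: Zhang2022LandauSiegel, §18 pp.99–100] -/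
theorem ded183_of_crude
    (h13 : ForAllLarge fun D _ χ => AssumptionA D χ → ∀ j ∈ ({1, 2, 3} : Finset ℕ),
      (Sj c' D j (a23 χ) (a23 χ)).re < 1100 * frakA χ / Real.log (bigP D))
    (hN : ∃ C : ℝ, ForAllLarge fun D _ χ => AssumptionA D χ → ∀ j ∈ ({1, 2, 3} : Finset ℕ),
      ‖Sj c' D j (a23 χ) (a23 χ)‖ ≤ C * (frakA χ + 1) / Real.log (bigP D)) :
    Ded183 c' :=
  ded183_of_steps c' h13 (ecal23Negligible_of_sjNorm c' hN)

/-- **(2.33) itself from the same inputs** (Z22 p.100: "This yields (2.33)"): with (18.3), Prop. 7.1,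
u013 and the implicit error-term control, `Skeleton.Ineq233 c′` (`Ξ_J < 3000𝔞𝔓` for large `D`)
follows through the banked `Skeleton.ineq233_of_bound` (`8800/π < 3000`, absorbing `o(𝔓)` by
`𝔞 ≫ 1`, Lemma 5.7 — `Skeleton.frakALowerBound_holds`). Kernel-checked.
[cite: Zhang2022LandauSiegel, §18 pp.99–100; §2 (2.33)] -/
theorem ineq233_of_steps (h183 : Eq183 c') (h71 : Prop71 c')
    (h13 : ForAllLarge fun D _ χ => AssumptionA D χ → ∀ j ∈ ({1, 2, 3} : Finset ℕ),
      (Sj c' D j (a23 χ) (a23 χ)).re < 1100 * frakA χ / Real.log (bigP D))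
    (hE : ∀ ε : ℝ, 0 < ε → ForAllLarge fun D _ χ => AssumptionA D χ →
      Ecal c' D (a23 χ) (a23 χ) ≤ ε * frakP D) :
    Skeleton.Ineq233 c' :=
  ineq233_of_bound (bound183_of_steps c' h183 h71 (step18_u014_of_u013 c' h13) hE)
    frakALowerBound_holds

end Ending

end Literature.NumberTheory.LFunctions.Zhang2022.Sec18Ded183
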